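import Summits.Parity.GeneralizedHardyLittlewood.Theses.PrimeLevelFamEdge
import Literature.NumberTheory.LFunctions.KMVSignedSecondGap
import Literature.NumberTheory.LFunctions.CentralValueFamilyLevelAvgTotal
import Literature.Barriers.Parity.SiegelZeroDichotomy
import Literature.NumberTheory.LFunctions.KMVMomentsToHalfEdgeAtLevel

/-!
# Route `PrimeLevelFamEdge` — TYPED IDEA DELTAS against the door U-d, deck 2: WINDOWS AND AVERAGES
(cell ls-idea; cards K6-1 «log-excess edge» moment side, K4-1 «resonance-free window», K-I3-1
«parity-twisted level Kuznetsov»)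

PROOF-FREE `def … : Prop` deltas (idea cards that passed the cell's critics), stated in the tree's
KMV2000 / `CentralValueFamilyHalfEdge` vocabulary against `PrimeLevelFamEdge.MomentsBeyondDiagonal`
(K_A, stmt-Parity-20007) / `.BeyondDiagonalBeatsQuarter` (K_B, stmt-Parity-20343) / the edge
`FamEdgeWeightTwo`, plus KERNEL glue where it is a one-liner into an existing consumer; otherwise
«glue: CLAIMED, gap = …». Imports: the route file + Literature only (theses-cone discipline).
NOTHING HERE IS ASSERTED: every `def … : Prop` is a hypothesis SHAPE with the card's parameters
explicit; «typed ≠ proved; no exceptional-zero theorem (no Landau–Siegel exclusion, no Theorem 1–2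
of arXiv:2211.02515, no repaired Margin232) is proved by ideation». Card texts / critic verdicts:
`run/shared/lean/pub/ls-idea/CARDS.md`, `cards/<seat>.md`, `ls-idea-ref-{1,2,3}/card-verdicts.md`.
-/

noncomputable section

namespace Summit.Parity.GeneralizedHardyLittlewood.Theorems.PrimeLevelFamEdgeIdeaDeltas

open Polynomial Filter Topology Finset
open Literature.NumberTheory.LFunctions
open Literature.NumberTheory.LFunctions.KMV2000
open Literature.NumberTheory.LFunctions.CentralValueFamilyHalfEdge
open Summit.Parity.GeneralizedHardyLittlewood.Theses.PrimeLevelFamEdge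

/-! ## §1 K6-1 «LOG-EXCESS EDGE» — the MOMENT side: a Δ-UNIFORM one-sided control on the
shrinking window Δ'_q = 1 + B·log log q̂/log q̂ (lens-6; critic A PASS, B PASS+FIX, C PASS-with-FIX
«type a Δ-uniform MomentAsymptotics») -/

/-- The LOG-WINDOW length exponent `Δ'_q = 1 + B · log log q̂ / log q̂`, i.e. mollifier length
`M = q̂^{Δ'_q} = q̂ · (log q̂)^B` — «just beyond the diagonal» by a log power (card K6-1: the least θ
the door needs). [cite: KowalskiMichelVanderKam2000, p. 28 L73–L77 («the length of the mollifier Δ beyond 1»)] -/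
def logWindowExponent (B : ℝ) (q : ℕ) : ℝ :=
  1 + B * Real.log (Real.log (qhat q)) / Real.log (qhat q)

/-- **K6-1 «LOG-EXCESS EDGE», moment side (lens-6).** Mechanism (card): the consumer edge theorem is
LINEAR in the excess over ½ (`CentralValueFamilyHalfEdge.lOne_lowerBound_of_EStarFam`; log-excess
twin `EStarFamLog`, lens-6 sketch rc 0), and the exponent budget `A < 2022` tolerates an excess
`(log q)^{−b}`; so the LEAST length the door needs is `θ = 1 + B·log log q/log q`, with a ONE-SIDED,
CONSTANT-FACTOR requirement: an upper bound for the mollified second moment at `X²`, `Q = 1`,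
mollifier `q̂ (log q̂)^B`, below the band — here with slack `(4 − η)·(Δ'_q − 1)` against the band
`4(Δ'_q − 1)/Δ'_q` — with constants UNIFORM in the shrinking window (critic C FIX-1: the tree's
`KMV2000.MomentAsymptotics` is `∀ Δ ∃ C`, fixed Δ; this predicate is the Δ-uniform form on the log
window). Controls: G-24 C4′ restricted to the log window; K_A famE-02/E-060 weakened to one-sided.
Why novel (card, critics A/C): no located text shortens «Δ > 1» to a log-power window or states the
one-sided constant-factor form. Falsifier: bed D130-1 slope `m_R/(Δ'−1) ≈ 0.5` at 1.02–1.05 (model-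
scaled). HIDDEN INPUTS recorded by the typer (STATUS 17:35Z): the consumer also needs the twisted
half AT RATE `p₂(N) ≥ ½ − o(excess)` (tree has only `½ − ε`: `iwaniec2006_twistedHalf`). Glue to the
edge: CLAIMED — gap = a q-DEPENDENT-LENGTH version of
`CentralValueFamilyHalfEdge.primeLevelFamilyTwo_EStarFam_of_momentAsymptotics_pb` (M-sized, not in
tree). A PREDICATE in `(B, η)`; nothing asserted; typed ≠ proved.
[cite: KowalskiMichelVanderKam2000, §6 p. 19 (second-moment display) and p. 28 L73–L77] -/
def LogWindowUpperControl (B η : ℝ) : Prop :=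
  ∃ C : ℝ, ∃ q₁ : ℕ, ∀ (q : ℕ) [NeZero q], q.Prime → q₁ ≤ q →
    (∀ n : ℕ, (n : ℝ) ≠ qhat q ^ logWindowExponent B q) →
      (QhPQ q (X ^ 2) 1 (qhat q ^ logWindowExponent B q)).re ≤
        2 * (Real.pi ^ 2 / 6) ^ 2 *
            (qhat q / (logWindowExponent B q ^ 2 * Real.log (qhat q) ^ 2)) *
            (secondMomentForm (logWindowExponent B q) (X ^ 2) 1 +
              (4 - η) * (logWindowExponent B q - 1)) +
          C * qhat q * (Real.log (qhat q))⁻¹ ^ 3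

/-! ## §2 K4-1 «RESONANCE-FREE WINDOW» — the door's K_A UNDER (A)_D, at prime levels BELOW the
exceptional conductor's reach (lens-4 × lens-7; critics A PASS, C PASS, B per CARDS.md) -/

/-- **K4-1 ★ «RESONANCE-FREE WINDOW» (lens-4 × I7).** Mechanism (card): work UNDER the contradiction
hypothesis (A)_D «L(1,χ_D) < (log D)^{−A}» and run the untwisted KMV/IS mollified moments at ONE
compatible prime level `q` in the window `W(D) = [D^{1/δ}, D^{1/ρ})` (`δ` = IS's twisted uniformity
exponent, `ρ = ρ(η)` = exponent of the largest secondary Kloosterman modulus that can carry a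
main-order real-character resonance at mollifier length `q̂^{1+η}`): inside `W(D)` no resonating
modulus is divisible by `D`, Landau–Page pins every other real character of conductor `≤ D`, and
Deuring–Heilbronn (tree: `BGTZ2025.corollary11`) widens every non-χ_D zero-free region, so the
GRH slot of the dispersion ledger is filled EFFECTIVELY by (A) itself — EMITTING
`K_A^win := «(A)_D ⇒ MomentAsymptotics-shape displays with q-FREE principal tables at EVERY prime
q ∈ W(D)»`, constants uniform in `D ≥ D₀` and `q ∈ W(D)` (no «eventually in q»: the window is
bounded for each `D`). TYPED FORM below (both KMV displays, all admissible `P`, even/odd `Q`,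
`Δ' ∈ (1, 1+η]`). Controls: C4 MIN-PREMISE (premise = (A) + DH, NO zero-free input at scale q) +
C4′ on the short window; PIN P-circ broken by SCALE SEPARATION. Why novel (card, critic C PASS): no
filed line or print restricts the LEVEL to a D-window under (A) and discharges the rest by DH
(nearest: KMV p. 28 GRH slot named; Conversations p. 97). Falsifiers: F1 window arithmetic
(`ρ(η) < δ_IS`?), F2 (A)-world consistency audit, F3 bed D130-1 at 1.02/1.05. Glue: the CONSUMER side is lens-4's kernel-checked sketch
`CentralValueFamily.CompatibleSupplyGoodA p₁ a δ K A` + `lOne_lowerBound_of_compatibleSupplyGoodA`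
(HOME/ls-idea-lens-4/Sketch_EStarFamWindow.lean, rc 0; to land under Literature); the MOMENT→EDGE
step `KAWindow … → CompatibleSupplyGoodA …` at one windowed level is CLAIMED — gap = a windowed
copy of `CentralValueFamilyHalfEdge.primeLevelFamilyTwo_EStarFam_of_momentAsymptotics_pb` (M-sized). PARAMETERS `A, δ, ρ, η`, tables; nothing asserted; typed ≠ proved.
[cite: KowalskiMichelVanderKam2000, §6 p. 19 and p. 28 L74–L77] [cite: IwaniecConversations2006, §7 p. 97 and §9 (9.6)] -/
def KAWindow (A : ℕ) (δ ρ η : ℝ) (T₁ T₂ : ℝ → ℝ[X] → ℝ[X] → ℝ) : Prop :=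
  ∀ P Q : ℝ[X], Admissible P → IsEvenOrOdd Q → ∀ Δ' : ℝ, 1 < Δ' → Δ' ≤ 1 + η →
    ∃ C : ℝ, ∃ D₀ : ℕ, ∀ (D : ℕ) [NeZero D] (χ : DirichletCharacter ℂ D), D₀ ≤ D →
      χ.IsPrimitive → MulChar.IsQuadratic χ → (χ.LFunction 1).re < ((Real.log D) ^ A)⁻¹ →
        ∀ (q : ℕ) [NeZero q], q.Prime → (D : ℝ) ^ (1 / δ) ≤ q → (q : ℝ) < (D : ℝ) ^ (1 / ρ) →
          (∀ n : ℕ, (n : ℝ) ≠ qhat q ^ Δ') →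
            ‖LhPQ q P Q (qhat q ^ Δ') -
                ((riemannZeta 2 * ((Real.sqrt (qhat q) / (Δ' * Real.log (qhat q)) : ℝ) : ℂ)) *
                  ((linForm Δ' P Q + T₁ Δ' P Q : ℝ) : ℂ))‖ ≤
              C * Real.sqrt (qhat q) * (Real.log (qhat q))⁻¹ ^ 2 ∧
            ‖QhPQ q P Q (qhat q ^ Δ') -
                ((2 * riemannZeta 2 ^ 2 * ((qhat q / (Δ' ^ 2 * Real.log (qhat q) ^ 2) : ℝ) : ℂ)) *
                  ((secondMomentForm Δ' P Q + T₂ Δ' P Q : ℝ) : ℂ))‖ ≤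
              C * qhat q * (Real.log (qhat q))⁻¹ ^ 3

/-! ## §3 K-I3-1 «PARITY-TWISTED LEVEL KUZNETSOV» — the χ_D(−q)-twisted level average of the
mollified second moment, its secondary (Eisenstein) table `E`, and the compatible-window edge it
decides (lens-3; critics A PASS, C PASS-with-FIX, B per CARDS.md) -/

/-- **K-I3-1, mechanism level: the PARITY-TWISTED level-averaged second table.** For admissible `P`,
`Q = 1`, `Δ' ∈ (1, b)`, all real primitive `χ mod D` with `D ≤ N^δ`: the χ(−q)-TWISTED dyadic block
sum of the signed second gaps over the good primes `q ∈ (N, 2N]` has main term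
`E(Δ', P, D) · Σ_q mainScale q Δ'` to relative `o(1)` — `E` being the card's secondary table (the
Eisenstein(χ_D) contribution of Kuznetsov on Γ₀(d·|D|) with nebentypus χ_D after the
Blomer–Milićević identity; «the ONLY terms with a pole», card (ii)). The compatible-class average is
`½(plain + χ_D(−1)·twisted)`, so with the untwisted level-averaged table (famE-03) this decides the
door in the level-averaged family: `T₂^{avg,χ} = T₂^{avg} + E`. Controls: famE-02 in level-averaged-
with-parity form; GAP Part F row F5 margin `η₀ − E`. Why novel (card, critic C): print records the
phenomenon with NO mechanism («magic conspiracy», LNM 1891 p. 97 L15); Kuznetsov with a character OF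
THE MODULUS (Blomer–Milićević 2015) is nowhere applied to the parity-restricted level family.
Falsifiers: F1 class-cost re-read of bed-6 v3 rows (free), F2 one-page pencil (does `E` carry
`1/L(1,χ_D)²`?). `E`, `b`, `δ` are PARAMETERS; nothing asserted; typed ≠ proved.
[cite: KowalskiMichelVanderKam2000, §6 p. 19 (second-moment display)] [cite: IwaniecConversations2006, §7 p. 97 L13–L15] -/
def ParityTwistedSecondTable (b δ : ℝ) (E : ℝ → ℝ[X] → ℕ → ℝ) : Prop :=
  ∀ P : ℝ[X], Admissible P → ∀ Δ' : ℝ, 1 < Δ' → Δ' < b → ∀ ε : ℝ, 0 < ε → ∃ N₀ : ℕ, ∀ N : ℕ,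
    N₀ ≤ N → ∀ (D : ℕ) [NeZero D] (χ : DirichletCharacter ℂ D), χ.IsPrimitive →
      MulChar.IsQuadratic χ → (D : ℝ) ≤ (N : ℝ) ^ δ →
        ‖(∑ q ∈ goodPrimes Δ' N, χ (-(q : ZMod D)) * signedSecondGap P 1 Δ' q) -
            ((E Δ' P D : ℝ) : ℂ) * ∑ q ∈ goodPrimes Δ' N, mainScale q Δ'‖ ≤
          ε * ∑ q ∈ goodPrimes Δ' N, ‖mainScale q Δ'‖

/-- **K-I3-1, the untwisted companion (famE-03 shape): the PLAIN level-averaged second table**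
`T₂avg` — the dyadic good-prime block sums of the signed gaps have main term `T₂avg(Δ',P)·Σ mainScale`
(Iwaniec–Sarnak's level-averaged off-diagonal main term; «announced in print; statement unlocated»
per critic C: Conversations p. 97 L16, IS2000 acq-11417). Prime levels only (the bed's D130-3 family).
A PREDICATE; nothing asserted. [cite: IwaniecConversations2006, §7 p. 97 L9–L16] -/
def LevelAvgSecondTable (b : ℝ) (T₂avg : ℝ → ℝ[X] → ℝ) : Prop :=
  ∀ P : ℝ[X], Admissible P → ∀ Δ' : ℝ, 1 < Δ' → Δ' < b → ∀ ε : ℝ, 0 < ε → ∃ N₀ : ℕ, ∀ N : ℕ,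
    N₀ ≤ N →
      ‖(∑ q ∈ goodPrimes Δ' N, signedSecondGap P 1 Δ' q) -
          ((T₂avg Δ' P : ℝ) : ℂ) * ∑ q ∈ goodPrimes Δ' N, mainScale q Δ'‖ ≤
        ε * ∑ q ∈ goodPrimes Δ' N, ‖mainScale q Δ'‖

/-- **K-I3-1, edge level (the seat's typing request; critic B: «PASS as DIAGNOSIS · STRIKE as
door-clause», so this Prop is typed as the HYPOTHESIS SHAPE of the card's NO-GO dichotomy, not as a
live door): the COMPATIBLE-WINDOW edge with the conspiracy's cost explicit.** `TwistedLevelEdge η₀ E δ` := Iwaniec–Sarnak's level-averaged (7.5)-edge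
over the COMPATIBLE window (levels `N ∈ [X,2X]` squarefree, `(N,D) = 1`, `χ_D(−N) = 1`; tree scheme
`compatibleWindow`, guarded `ntWindow`) at proportion `½ + η₀ − E` for the weight-2 family
`iwaniecSarnakFamily 2`, uniformly in `D ≤ X^δ` — `η₀` = the plain level-averaged excess, `E` = the
parity-twisted (Eisenstein) cost at the chosen length. The card's dichotomy: `E < η₀` uniformly ⇒ the
door opens in the level-averaged family (glue below, KERNEL); `E` of size `η₀` exactly when
`L(1,χ_D)·log Q` is small ⇒ a NO-GO lemma for parity-twisted level averages (Barriers candidate).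
A PREDICATE in `(η₀, E, δ)`; nothing asserted; typed ≠ proved. [cite: IwaniecConversations2006, §7 (7.5) and p. 97 L13–L15] -/
def TwistedLevelEdge (η₀ E δ : ℝ) : Prop :=
  (iwaniecSarnakFamily 2).EStarFamLevelAvg ((iwaniecSarnakFamily 2).ntWindow compatibleWindow)
    (1 / 2 + η₀ - E) 2 δ

/-- **Glue (kernel): what the struck door-clause WOULD give — if the conspiracy's cost stayed below the
excess, the level-averaged edge closes the rung (critic B strikes exactly the premise `E < η₀`
uniformly in `D ≤ X^δ` as W-COH/R1′; recorded so the NO-GO lemma has its positive twin in the kernel).** `TwistedLevelEdge η₀ E δ` with `E < η₀`, together with the printed twisted half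
`iwaniec2006_twistedHalf` (proportion `½ − ε`, any `ε`), Lapid–Rallis non-negativity and the two
printed level-averaged mass/mixed-moment shapes on the compatible window (hypotheses, as in the tree's
`lOne_lowerBound_of_EStarFamLevelAvg_compatibleWindow_total`), gives `L(1,χ_D) ≥ c (log D)⁻⁴` for all
large `D` (= `EventualLOneLowerBound 4` shape, hence `LOneLowerBound 4` → `Theorem1` by the route's
monotone glue). One line through the tree consumer with `ε := (η₀ − E)/2`.
[cite: IwaniecConversations2006, §7 (7.7) and p. 97 L15] -/
theorem lOne_lowerBound_of_twistedLevelEdge {η₀ E δ : ℝ} (hδ : 0 < δ) (hEη : E < η₀)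
    (hedge : TwistedLevelEdge η₀ E δ)
    (hLR : IwaniecSarnak.lapidRallis2003_theorem1_gl2Twist)
    (hTw : IwaniecSarnak.iwaniec2006_twistedHalf)
    (hsh : (iwaniecSarnakFamily 2).EvenShareAvg compatibleWindow δ)
    (hmix : (iwaniecSarnakFamily 2).MixedOverTotalMassAvg compatibleWindow δ) :
    ∃ c : ℝ, 0 < c ∧ ∃ D₀ : ℕ, ∀ (D : ℕ) [NeZero D] (χ : DirichletCharacter ℂ D), D₀ ≤ D →
      χ.IsPrimitive → MulChar.IsQuadratic χ →
        c * ((Real.log D) ^ 4)⁻¹ ≤ (χ.LFunction 1).re :=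
  lOne_lowerBound_of_EStarFamLevelAvg_compatibleWindow_total (k := 2) le_rfl hLR
    (p₁ := 1 / 2 + η₀ - E) (p₂ := 1 / 2) (ε := (η₀ - E) / 2) (by linarith) hδ hsh hmix
    (hTw 2 le_rfl ⟨1, rfl⟩) hedge (by linarith)

/-! ## §4 K-L7-1 ★ «EXCEPTIONAL PERIODICITY LEVER» — K_A IN THE (A)_D-WORLD with (D, q)-dependent
tables at compatible levels in a power window (lens-7; critics A PASS · B PASS ★ (priced: F1 dual-length
ledger with the b-tail) · C PASS) -/

/-- **K-L7-1 ★ «EXCEPTIONAL PERIODICITY LEVER» (lens-7).** Mechanism (card): under (A)_D the exact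
identity `μ = (χ_D·μ²) ∗ g_B` makes the arithmetic weight on the LONG variable of the beyond-diagonal
off-diagonal (μ in the mollifier, Λ in the explicit formula) PERIODIC mod `D` × smooth × a short
`b`-tail, so Poisson summation in the long periodic variable `m` REPLACES GRH: cancellation comes from
COMPLETENESS in `m`, never from μ-cancellation (a referee who finds a step needing power savings in a
`b`- or `d`-sum kills outlet (a)). EMITS (a) candidate closed forms `T₁^{(A)}, T₂^{(A)}(Δ', P, Q; D,
χ_D(q), χ_D(−1))` = the zero-frequency terms — i.e. K_A in lens-7's frame K-L7-0 (the (A)-localised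
ONE-compatible-level form; consumer side = `CentralValueFamily.CompatibleSupplyGoodA`, landed p553195),
after which C4′ (`T₂/second` vs the slack) is a formula check. TYPED FORM: both KMV displays at EVERY
prime level `q` of a power window `[D^{K₁}, D^{K₂}]` COMPATIBLE with `χ_D` (`χ_D(−q) = 1`), for all
large `D` in the (A)_D-world `L(1,χ_D) < (log D)^{−A}`, with tables `Tᵢ D q` allowed to depend on the
modulus and the level (the card: only through `(D, χ_D(q), χ_D(−1))` and `M^{2β−1}` — not enforced by
the type), constants uniform in `D` and `q`. Generalises §2's `KAWindow` (q-free tables, window below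
the resonance reach) to the resonant range `q ≥ D⁴` where the exceptional term is PRESENT and explicit.
Controls: C4 K_A in MIN-PREMISE (A)-localised currency → C4′ by formula (census R-16/R-28). Why novel
(card, critic C PASS): nobody applies the exact Möbius factorisation to a single-L mollifier BEYOND the
diagonal (BPZ use a product + short lacunary mollifier). Falsifier: F1 = redo the m-Poisson dual length
across KMV's full c-range with the b-tail (ref-2's price). PARAMETERS `A, K₁, K₂, η`, tables; nothing
asserted; glue to `CompatibleSupplyGoodA` CLAIMED (same one-level moments→edge gap as K4-1); typed ≠ proved.
[cite: IwaniecConversations2006, §8 (8.2), (8.5)–(8.6) and §7 p. 97] [cite: KowalskiMichelVanderKam2000, §6 p. 19 and p. 28 L73–L77] -/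
def KAExceptional (A : ℕ) (K₁ K₂ η : ℝ) (T₁ T₂ : ℕ → ℕ → ℝ → ℝ[X] → ℝ[X] → ℝ) : Prop :=
  ∀ P Q : ℝ[X], Admissible P → IsEvenOrOdd Q → ∀ Δ' : ℝ, 1 < Δ' → Δ' ≤ 1 + η →
    ∃ C : ℝ, ∃ D₀ : ℕ, ∀ (D : ℕ) [NeZero D] (χ : DirichletCharacter ℂ D), D₀ ≤ D →
      χ.IsPrimitive → MulChar.IsQuadratic χ → (χ.LFunction 1).re < ((Real.log D) ^ A)⁻¹ →
        ∀ (q : ℕ) [NeZero q], q.Prime → (D : ℝ) ^ K₁ ≤ q → (q : ℝ) ≤ (D : ℝ) ^ K₂ →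
          χ (-(q : ZMod D)) = 1 → (∀ n : ℕ, (n : ℝ) ≠ qhat q ^ Δ') →
            ‖LhPQ q P Q (qhat q ^ Δ') -
                ((riemannZeta 2 * ((Real.sqrt (qhat q) / (Δ' * Real.log (qhat q)) : ℝ) : ℂ)) *
                  ((linForm Δ' P Q + T₁ D q Δ' P Q : ℝ) : ℂ))‖ ≤
              C * Real.sqrt (qhat q) * (Real.log (qhat q))⁻¹ ^ 2 ∧
            ‖QhPQ q P Q (qhat q ^ Δ') -
                ((2 * riemannZeta 2 ^ 2 * ((qhat q / (Δ' ^ 2 * Real.log (qhat q) ^ 2) : ℝ) : ℂ)) *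
                  ((secondMomentForm Δ' P Q + T₂ D q Δ' P Q : ℝ) : ℂ))‖ ≤
              C * qhat q * (Real.log (qhat q))⁻¹ ^ 3

/-- Bookkeeping (proved): §2's `KAWindow` (q-FREE tables on `[D^{1/δ}, D^{1/ρ})`, all levels) gives
`KAExceptional` on any CLOSED sub-window `[D^{1/δ}, D^{K₂}]`, `K₂ < 1/ρ`, with constant tables (the
compatibility restriction only weakens). [cite: KowalskiMichelVanderKam2000, §6 p. 19] -/
theorem kAExceptional_of_kAWindow {A : ℕ} {δ ρ η K₂ : ℝ} {T₁ T₂ : ℝ → ℝ[X] → ℝ[X] → ℝ}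
    (h : KAWindow A δ ρ η T₁ T₂) (hK₂ : K₂ < 1 / ρ) :
    KAExceptional A (1 / δ) K₂ η (fun _ _ ↦ T₁) (fun _ _ ↦ T₂) := by
  intro P Q hP hQ Δ' h1 h2
  obtain ⟨C, D₀, hC⟩ := h P Q hP hQ Δ' h1 h2
  refine ⟨C, max D₀ 2, fun D _ χ hD hprim hquad hA q _ hq hlo hhi _ hgood ↦ ?_⟩
  have hD2 : (2 : ℝ) ≤ D := by exact_mod_cast le_trans (le_max_right _ _) hD
  have hlt : (q : ℝ) < (D : ℝ) ^ (1 / ρ) :=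
    lt_of_le_of_lt hhi (Real.rpow_lt_rpow_of_exponent_lt (by linarith) hK₂)
  exact hC D χ (le_trans (le_max_left _ _) hD) hprim hquad hA q hq hlo hlt hgood

/-! ## §5 K6-3 «DH ANSWER SHEET» — the instrument's decided alternative (b) as a typed negative-
knowledge Prop (lens-6 × I7; critics A PASS as INSTRUMENT · B PASS instrument · C FIX→PASS on repair) -/

/-- **K6-3 «DEURING–HEILBRONN MAKES THE A-WORLD OFF-DIAGONAL EXPLICIT», outcome (b) typed.** The
card is an INSTRUMENT (not a route): inside the (A)-world `L(1,χ_D) ≤ (log D)^{−A'}`, Linnik's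
exceptional-zero repulsion (Conversations (9.6)) + the §8 dictionary (`ν = μ·λ`, (8.2)/(8.6)) give
an explicit evaluation of the individual-prime-level off-diagonal `OD₂` of the mollified second moment
in K6-1's log window, DECIDING (a) «E_β negligible against η(Δ')·second — the door survives the
A-world at leading order» or (b) «UnboundedSiegelZeros ⇒ ¬K_A» (typed negative knowledge). This
Prop is outcome (b) GRADED BY QUALITY `η₀` — Siegel zeros of quality `≥ η₀` at arbitrarily large
conductors (the antecedent of the tree's registered OPEN statement `Literature.Barriers.Parity.UnboundedSiegelZeros`
at one quality, `unboundedSiegelZeros_iff_forall_antecedent`) refute the LEVEL-FREE existence crux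
K_A `MomentsBeyondDiagonal` — i.e. the route header's PIN P-R1′ («K_A with level-independent tables is
¬(A)-strength») promoted from a remark to a statement one could prove with the instrument. Its
contrapositive is the CIRCULARITY CERTIFICATE direction: a level-free K_A proved would refute
`UnboundedSiegelZeros`. Controls: famE-02/E-060 K_A why-it-might-fail clause; G-24 supplies η(Δ');
G-27 (DH width) is the consumed input. NOT ASSERTED (neither (a) nor (b) is decided by typing);
typed ≠ proved. [cite: IwaniecConversations2006, §9 (9.6) and §8 (8.2)/(8.6)]
[cite: KowalskiMichelVanderKam2000, p. 28 L73–L77] -/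
def AWorldKillsLevelFreeKA (η₀ : ℝ) : Prop :=
  (∀ q₀ : ℕ, ∃ (q : ℕ) (_ : NeZero q) (χ : DirichletCharacter ℂ q) (η : ℝ),
      q₀ ≤ q ∧ η₀ ≤ η ∧ Literature.Barriers.Parity.IsSiegelZero χ η) → ¬ MomentsBeyondDiagonal

/-- Bookkeeping (proved): the tree's registered OPEN statement `UnboundedSiegelZeros` (Siegel zeros
of EVERY quality at arbitrarily large conductor) is exactly «the antecedent at every quality `η₀`»,
so outcome (b) GRADED BY QUALITY reads: `(∀ η₀, AWorldKillsLevelFreeKA η₀)`-type statements are the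
circularity-certificate direction «a level-free K_A refutes Siegel zeros of quality ≥ η₀ i.o.».
[cite: IwaniecConversations2006, §9 (9.6)] -/
theorem unboundedSiegelZeros_iff_forall_antecedent :
    Literature.Barriers.Parity.UnboundedSiegelZeros ↔
      ∀ η₀ : ℝ, ∀ q₀ : ℕ, ∃ (q : ℕ) (_ : NeZero q) (χ : DirichletCharacter ℂ q) (η : ℝ),
        q₀ ≤ q ∧ η₀ ≤ η ∧ Literature.Barriers.Parity.IsSiegelZero χ η :=
  Iff.rfl

/-- Bookkeeping (proved): if level-free K_A holds, outcome (b) at quality `η₀` says Siegel zeros of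
quality `≥ η₀` do NOT occur at arbitrarily large conductors (the circularity-certificate direction).
[cite: IwaniecConversations2006, §9 (9.6)] -/
theorem not_frequently_siegelZero_of_kA {η₀ : ℝ} (h : AWorldKillsLevelFreeKA η₀)
    (hA : MomentsBeyondDiagonal) :
    ¬ ∀ q₀ : ℕ, ∃ (q : ℕ) (_ : NeZero q) (χ : DirichletCharacter ℂ q) (η : ℝ),
      q₀ ≤ q ∧ η₀ ≤ η ∧ Literature.Barriers.Parity.IsSiegelZero χ η :=
  fun hS ↦ h hS hA

/-! ## §6 K4-1 ★ glue, KERNEL (typer): `KAWindow` ⇒ the (A)-localised one-level edge ⇒ the rung leaf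
(the moments→edge step that §2 left CLAIMED, via `CentralValueFamilyHalfEdge.compatibleSupplyGoodA_of_windowDisplays_pb`
of `Literature/…/KMVMomentsToHalfEdgeAtLevel.lean`) -/

/-- **K4-1 ★ glue (KERNEL): `KAWindow` + a value `> ¼` at `X²` on a generic length `Δ' ∈ (1, min(1+η, 3/2))`
+ a compatible supply INSIDE the window (`δ' ≤ δ`, `K < 1/ρ`; `δ > 0`) ⇒ `primeLevelFamilyTwo.CompatibleSupplyGoodA`**
(lens-4's consumer shape, p553195), under the repaired Petersson bound and Lapid–Rallis only. The window
inclusion: `D ≤ q^{δ'}`, `δ' ≤ δ` ⇒ `D^{1/δ} ≤ q`; `q ≤ D^K`, `K < 1/ρ`, `D ≥ 2` ⇒ `q < D^{1/ρ}`.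
[cite: KowalskiMichelVanderKam2000, Thm. 6.1 (32) and §6 p. 19] [cite: IwaniecConversations2006, §7 (7.5), p. 97] -/
theorem compatibleSupplyGoodA_of_kAWindow
    (hP : KowalskiMichel2000.kowalskiMichel2000_peterssonBound)
    (hLR : IwaniecSarnak.lapidRallis2003_theorem1_gl2Twist)
    {A : ℕ} {δ ρ η δ' K : ℝ} {T₁ T₂ : ℝ → ℝ[X] → ℝ[X] → ℝ} (hKA : KAWindow A δ ρ η T₁ T₂)
    (hδ : 0 < δ) (hδδ : δ' ≤ δ) (hKρ : K < 1 / ρ)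
    {Δ' : ℝ} (h1 : 1 < Δ') (hη : Δ' ≤ 1 + η) (h32 : Δ' < 3 / 2)
    (hgen : ∀ q : ℕ, q.Prime → 40 ≤ q → ∀ n : ℕ, (n : ℝ) ≠ qhat q ^ Δ')
    (hc₂ : 0 < secondMomentForm Δ' (X ^ 2) 1 + T₂ Δ' (X ^ 2) 1)
    (hR : 1 / 4 < (linForm Δ' (X ^ 2) 1 + T₁ Δ' (X ^ 2) 1) ^ 2 /
      (2 * (secondMomentForm Δ' (X ^ 2) 1 + T₂ Δ' (X ^ 2) 1)))
    (hsup : primeLevelFamilyTwo.CompatibleSupply δ' K) :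
    primeLevelFamilyTwo.CompatibleSupplyGoodA
      ((linForm Δ' (X ^ 2) 1 + T₁ Δ' (X ^ 2) 1) ^ 2 /
          (2 * (secondMomentForm Δ' (X ^ 2) 1 + T₂ Δ' (X ^ 2) 1)) + 1 / 4) 2 δ' K A := by
  refine compatibleSupplyGoodA_of_windowDisplays_pb hP hLR (by linarith) h32 ?_ hgen hc₂ hR hsup
  obtain ⟨C, D₀, H⟩ := hKA (X ^ 2) 1 admissible_X_sq isEvenOrOdd_one Δ' h1 hη
  refine ⟨C, max D₀ 2, fun D _ χ hD hprim hquad hA q _ hq hlo hhi hg ↦ ?_⟩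
  have hD2 : (2 : ℝ) ≤ D := by exact_mod_cast le_trans (le_max_right _ _) hD
  have hq1 : (1 : ℝ) ≤ q := by exact_mod_cast hq.one_lt.le
  have hlo' : (D : ℝ) ^ (1 / δ) ≤ q := by
    have e1 : (D : ℝ) ^ (1 / δ) ≤ ((q : ℝ) ^ δ') ^ (1 / δ) :=
      Real.rpow_le_rpow (by positivity) hlo (by positivity)
    have e2 : ((q : ℝ) ^ δ') ^ (1 / δ) = (q : ℝ) ^ (δ' / δ) := by
      rw [← Real.rpow_mul (by positivity)]
      ring_nf
    have e3 : (q : ℝ) ^ (δ' / δ) ≤ (q : ℝ) ^ (1 : ℝ) :=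
      Real.rpow_le_rpow_of_exponent_le hq1 (by rw [div_le_one hδ]; exact hδδ)
    rw [Real.rpow_one] at e3
    rw [e2] at e1
    exact e1.trans e3
  have hhi' : (q : ℝ) < (D : ℝ) ^ (1 / ρ) :=
    lt_of_le_of_lt hhi (Real.rpow_lt_rpow_of_exponent_lt (by linarith) hKρ)
  exact H D χ (le_trans (le_max_left _ _) hD) hprim hquad hA q hq hlo' hhi' hg

/-- **K4-1 ★ end-to-end (KERNEL modulo the card's analytic crux and the printed shapes): `KAWindow` ⇒
`L(1,χ_D) ≥ c (log D)^{−max(A,4)}`** for all large `D` — §6's glue fed into lens-4's windowed consumer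
`lOne_lowerBound_of_compatibleSupplyGoodA` (p553195). Hypotheses beyond `KAWindow` and the value
inequality: the repaired Petersson bound, Lapid–Rallis, a compatible supply inside the window, and the
pointwise printed shapes (non-negativity, even mass, mixed moment, twisted half at `p₂`) with
`value + ¼ + p₂ > 1`. [cite: IwaniecConversations2006, §7 (7.7)] -/
theorem lOne_lowerBound_of_kAWindow
    (hP : KowalskiMichel2000.kowalskiMichel2000_peterssonBound)
    (hLR : IwaniecSarnak.lapidRallis2003_theorem1_gl2Twist)
    {A : ℕ} {δ ρ η δ' K : ℝ} {T₁ T₂ : ℝ → ℝ[X] → ℝ[X] → ℝ} (hKA : KAWindow A δ ρ η T₁ T₂)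
    (hδ : 0 < δ) (hδδ : δ' ≤ δ) (hK : 0 < K) (hKρ : K < 1 / ρ)
    {Δ' : ℝ} (h1 : 1 < Δ') (hη : Δ' ≤ 1 + η) (h32 : Δ' < 3 / 2)
    (hgen : ∀ q : ℕ, q.Prime → 40 ≤ q → ∀ n : ℕ, (n : ℝ) ≠ qhat q ^ Δ')
    (hc₂ : 0 < secondMomentForm Δ' (X ^ 2) 1 + T₂ Δ' (X ^ 2) 1)
    (hR : 1 / 4 < (linForm Δ' (X ^ 2) 1 + T₁ Δ' (X ^ 2) 1) ^ 2 /
      (2 * (secondMomentForm Δ' (X ^ 2) 1 + T₂ Δ' (X ^ 2) 1)))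
    (hsup : primeLevelFamilyTwo.CompatibleSupply δ' K)
    (hnn : primeLevelFamilyTwo.Nonneg) (hmass : primeLevelFamilyTwo.EvenMassLower)
    (hmix : primeLevelFamilyTwo.MixedMomentUpper δ') {p₂ : ℝ}
    (htw : primeLevelFamilyTwo.TwistedHalf p₂ 2 δ')
    (hp : 1 < (linForm Δ' (X ^ 2) 1 + T₁ Δ' (X ^ 2) 1) ^ 2 /
      (2 * (secondMomentForm Δ' (X ^ 2) 1 + T₂ Δ' (X ^ 2) 1)) + 1 / 4 + p₂) :
    ∃ c : ℝ, 0 < c ∧ ∃ D₀ : ℕ, ∀ (D : ℕ) [NeZero D] (χ : DirichletCharacter ℂ D), D₀ ≤ D →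
      χ.IsPrimitive → MulChar.IsQuadratic χ →
        c * ((Real.log D) ^ (max A (2 * 2)))⁻¹ ≤ (χ.LFunction 1).re :=
  primeLevelFamilyTwo.lOne_lowerBound_of_compatibleSupplyGoodA hK hnn hmass hmix htw
    (compatibleSupplyGoodA_of_kAWindow hP hLR hKA hδ hδδ hKρ h1 hη h32 hgen hc₂ hR hsup) hp

/-! ## §7 K-L7-4 «PARITY SQUEEZE» — the two level types `χ_D(−q) = ±1` pin the odd part of an
(A)-world off-diagonal main term (lens-7 gen 2; critics A PASS as LEDGER/AUDIT INSTRUMENT on G-24 (A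
re-derived the squeeze) · B PASS (batch 13) · C batch 17). The card's three lines of inequalities,
PROVED as arithmetic (the hypotheses — compatible `S ≥ 2 − d` from (A) ∧ (7.6) ∧ non-negativity ∧
(7.4), incompatible `S ≥ 1` from Cauchy–Schwarz, `S = diag + Y ± X` with `diag = 1 + 1/Δ'` — are the
card's INPUTS and stay hypotheses here; nothing about L-functions is asserted). -/

/-- **K-L7-4 (i): a POSITIVE sign-symmetric off-diagonal main term is FORCED beyond `Δ' = 2`.** If at
compatible levels `diag + Y + X ≥ 2 − d` and at incompatible levels `diag + Y − X ≥ 1`, `diag = 1 + 1/Δ'`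
(all in `first²`-units), then `Y ≥ (Δ' − 2)/(2Δ') − d/2` (`≥ 1/10` at `Δ' = 2.5`, `→ ½`). Pure
arithmetic; the card's use: an (A)-world asymptotic valid at BOTH level types at some `Δ' > 2` with
`o(1)` symmetric part proves ¬(A) (door criterion by parity, U1). [cite: IwaniecConversations2006, §7 p. 97 L13–L15 (the two level classes)] -/
theorem paritySqueeze_symmetric_lowerBound {Δ' Y X d : ℝ} (hΔ : 0 < Δ')
    (hcompat : 2 - d ≤ 1 + 1 / Δ' + Y + X) (hincompat : 1 ≤ 1 + 1 / Δ' + Y - X) :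
    (Δ' - 2) / (2 * Δ') - d / 2 ≤ Y := by
  have e : (Δ' - 2) / (2 * Δ') = 1 / 2 - 1 / Δ' := by
    field_simp
  rw [e]
  linarith

/-- **K-L7-4 (ii): a purely ODD main term is PINNED to the window `[1 − 1/Δ' − d, 1/Δ']`.** With
`Y = 0` the two forced inequalities read `X ≥ 1 − 1/Δ' − d` (compatible) and `X ≤ 1/Δ'` (incompatible)
— TABLE (d omitted): `Δ' = 1.05: [0.048, 0.952]`, `1.25: [0.2, 0.8]`, `2: {½}`. Pure arithmetic.
[cite: IwaniecConversations2006, §7 p. 97 L13–L15] -/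
theorem paritySqueeze_odd_window {Δ' X d : ℝ}
    (hcompat : 2 - d ≤ 1 + 1 / Δ' + X) (hincompat : 1 ≤ 1 + 1 / Δ' - X) :
    1 - 1 / Δ' - d ≤ X ∧ X ≤ 1 / Δ' := by
  constructor <;> linarith

/-- **K-L7-4 (ii′): the odd window is EMPTY beyond the parity ceiling** — for `Δ' > 2` and deficit
`d < 1 − 2/Δ'` no purely odd main term satisfies both forced inequalities (so HORN 2 predicts that every
valid (A)-evaluation acquires a symmetric positive main term `Y` before `Δ' = 2`). Pure arithmetic.
[cite: IwaniecConversations2006, §7 p. 97 L13–L15] -/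
theorem paritySqueeze_odd_empty {Δ' X d : ℝ} (hd : d < 1 - 2 / Δ')
    (hcompat : 2 - d ≤ 1 + 1 / Δ' + X) (hincompat : 1 ≤ 1 + 1 / Δ' - X) : False := by
  obtain ⟨h1, h2⟩ := paritySqueeze_odd_window hcompat hincompat
  have e : 2 / Δ' = 2 * (1 / Δ') := by ring
  rw [e] at hd
  linarith

/-- **K-L7-4 in GAP-TABLE units (bookkeeping, proved): the lower edge of the odd window equals the
route's G-24 threshold.** `1 − 1/Δ'` in `first²`-units is `(Δ'−1)/(Δ'+1)` in `T₂/diag`-units, since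
`diag = 1 + 1/Δ'`: `(1 − 1/Δ')/(1 + 1/Δ') = (Δ' − 1)/(Δ' + 1)` (`1/41, 1/21, 1/9, 1/5` at
`Δ' = 1.05, 1.1, 1.25, 1.5`). [cite: KowalskiMichelVanderKam2000, Thm. 6.1 (32)] -/
theorem paritySqueeze_lowerEdge_gapUnits {Δ' : ℝ} (hΔ : 0 < Δ') :
    (1 - 1 / Δ') / (1 + 1 / Δ') = (Δ' - 1) / (Δ' + 1) := by
  have h1 : Δ' + 1 ≠ 0 := by linarith
  field_simp

end Summit.Parity.GeneralizedHardyLittlewood.Theorems.PrimeLevelFamEdgeIdeaDeltas
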